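import Mathlib.CategoryTheory.Conj
import Mathlib.Algebra.Group.Subgroup.Ker
import HarnessLib

/-!
# Transport of group actions by automorphisms along an isomorphism ([SemiAnbd] §3 p. 41, §5 p. 66)

Mochizuki, *Semi-graphs of anabelioids*, Publ. RIMS **42** (2006), §3 proof of Thm. 3.7 (iii) p. 41 (the
action of `π₁^temp(𝒢)` on the semi-graphs `𝒢_{∞,i}`) and §5 proof of Thm. 5.4 p. 66 ("entirely parallel":
the arithmetic group acts on the same trees) [cite: MochizukiSemiAnbd2006, Thm 5.4, p. 66].

GENERIC CATEGORY THEORY (cell row T54-B, tower third, file T2; plan/GAP-LEDGER.md G-w4d053-1): an action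
`ρ : E →* Aut X` transported along an isomorphism `Ψ : X ≅ Y` (`Iso.conjAut`), with the bookkeeping the
arithmetic tower needs: the transported action COVERS the same base action when `Ψ` is over the base
(`transportAct_comp_proj`), commutes with transition maps intertwined by the isomorphisms
(`transportAct_comp_trans`), takes prescribed values where `Ψ` intertwines them
(`transportAct_eq_of_comp_eq`), and has the same kernel (`ker_transportAct`).  With `X` a coset
semi-graph of `π₁^temp(𝒢)` carrying the canonical arithmetic action and `Y` the tree `𝒢_{∞,n}` of the
Galois tower this produces the `act` / `act_proj` / `trans_act` / "`ρ j (ι n) = act j n`" fields of the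
cell's `ArithLevelData`.  Nothing here bears on [IUTchIII] Cor. 3.12.
-/

namespace Literature.AnabelianGeometry.SemiGraphs

namespace AutTransport

open CategoryTheory

universe v u w

variable {C : Type u} [Category.{v} C] {E : Type w} [Group E] {X Y : C}

/-- **The transported action** `e ↦ Ψ⁻¹ ≫ ρ e ≫ Ψ` of `ρ : E →* Aut X` along `Ψ : X ≅ Y`.
[cite: MochizukiSemiAnbd2006, Thm 5.4, p. 66] -/
noncomputable def transportAct (ρ : E →* Aut X) (Ψ : X ≅ Y) : E →* Aut Y :=
  (Iso.conjAut Ψ).toMonoidHom.comp ρ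

/-- The underlying morphism of the transported automorphism. [cite: MochizukiSemiAnbd2006, Thm 5.4, p. 66] -/
@[simp] theorem transportAct_hom (ρ : E →* Aut X) (Ψ : X ≅ Y) (e : E) :
    (transportAct ρ Ψ e).hom = Ψ.inv ≫ (ρ e).hom ≫ Ψ.hom := by
  simp [transportAct, Iso.conjAut_hom, Iso.conj_apply]

/-- The transported action has the same kernel. [cite: MochizukiSemiAnbd2006, Thm 5.4, p. 66] -/
theorem ker_transportAct (ρ : E →* Aut X) (Ψ : X ≅ Y) : (transportAct ρ Ψ).ker = ρ.ker := by
  ext e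
  simp only [MonoidHom.mem_ker, transportAct, MonoidHom.coe_comp, MulEquiv.coe_toMonoidHom,
    Function.comp_apply, MulEquiv.map_eq_one_iff]

/-- **The transported action covers the same base action** when `Ψ` lies over the base: if
`ρ e ≫ p_X = p_X ≫ σ e` and `Ψ ≫ p_Y = p_X` then `ρ^Ψ e ≫ p_Y = p_Y ≫ σ e`.
[cite: MochizukiSemiAnbd2006, Thm 5.4, p. 66] -/
theorem transportAct_comp_proj {B : C} (ρ : E →* Aut X) (Ψ : X ≅ Y) (pX : X ⟶ B) (pY : Y ⟶ B)
    (hΨ : Ψ.hom ≫ pY = pX) (σ : E →* Aut B) (hρ : ∀ e, (ρ e).hom ≫ pX = pX ≫ (σ e).hom) (e : E) :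
    (transportAct ρ Ψ e).hom ≫ pY = pY ≫ (σ e).hom := by
  have hinv : Ψ.inv ≫ pX = pY := by rw [← hΨ, Iso.inv_hom_id_assoc]
  rw [transportAct_hom, Category.assoc, Category.assoc, hΨ, hρ, ← Category.assoc, hinv]

/-- The same, for an action `ρ` OVER the base (`σ = 1`): `ρ^Ψ e ≫ p_Y = p_Y`.
[cite: MochizukiSemiAnbd2006, Thm 3.7(iii) p.41] -/
theorem transportAct_comp_proj_of_over {B : C} (ρ : E →* Aut X) (Ψ : X ≅ Y) (pX : X ⟶ B) (pY : Y ⟶ B)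
    (hΨ : Ψ.hom ≫ pY = pX) (hρ : ∀ e, (ρ e).hom ≫ pX = pX) (e : E) :
    (transportAct ρ Ψ e).hom ≫ pY = pY := by
  have hinv : Ψ.inv ≫ pX = pY := by rw [← hΨ, Iso.inv_hom_id_assoc]
  rw [transportAct_hom, Category.assoc, Category.assoc, hΨ, hρ, hinv]

/-- **The transported actions commute with intertwined transition maps**: if `Ψ ≫ t' = t ≫ Ψ'` and
`ρ e ≫ t = t ≫ ρ' e` then `ρ^Ψ e ≫ t' = t' ≫ ρ'^{Ψ'} e`. [cite: MochizukiSemiAnbd2006, Thm 5.4, p. 66] -/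
theorem transportAct_comp_trans {X' Y' : C} (ρ : E →* Aut X) (ρ' : E →* Aut X') (Ψ : X ≅ Y)
    (Ψ' : X' ≅ Y') (t : X ⟶ X') (t' : Y ⟶ Y') (ht : Ψ.hom ≫ t' = t ≫ Ψ'.hom)
    (hρ : ∀ e, (ρ e).hom ≫ t = t ≫ (ρ' e).hom) (e : E) :
    (transportAct ρ Ψ e).hom ≫ t' = t' ≫ (transportAct ρ' Ψ' e).hom := by
  have hinv : Ψ.inv ≫ t = t' ≫ Ψ'.inv := by
    rw [← cancel_epi Ψ.hom, Iso.hom_inv_id_assoc, ← Category.assoc, ht, Category.assoc,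
      Iso.hom_inv_id, Category.comp_id]
  rw [transportAct_hom, transportAct_hom, Category.assoc, Category.assoc, ht,
    reassoc_of% (hρ e), reassoc_of% hinv]

/-- **Prescribed values**: if `ρ e = α` and `Ψ` intertwines `α` with `α'` then `ρ^Ψ e = α'` (used with
`α` a deck transformation of the coset semi-graph and `α'` the action of the same element on the tree).
[cite: MochizukiSemiAnbd2006, Thm 3.7(iii) p.41] -/
theorem transportAct_eq_of_comp_eq (ρ : E →* Aut X) (Ψ : X ≅ Y) {e : E} {α : Aut X} {α' : Aut Y}
    (h : ρ e = α) (hα : α.hom ≫ Ψ.hom = Ψ.hom ≫ α'.hom) : transportAct ρ Ψ e = α' := by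
  ext
  rw [transportAct_hom, h, hα, Iso.inv_hom_id_assoc]

/-- Transport along a composite isomorphism. [cite: MochizukiSemiAnbd2006, Thm 5.4, p. 66] -/
theorem transportAct_trans_eq {Z : C} (ρ : E →* Aut X) (Ψ : X ≅ Y) (Ψ' : Y ≅ Z) :
    transportAct ρ (Ψ ≪≫ Ψ') = transportAct (transportAct ρ Ψ) Ψ' := by
  ext e : 2
  simp only [transportAct_hom, Iso.trans_inv, Iso.trans_hom, Category.assoc]

end AutTransport

end Literature.AnabelianGeometry.SemiGraphs
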